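import Mathlib
import HarnessLib
import Literature.Analysis.FluidPDE.FirstIntegralTransportDefect
import Summits.NavierStokesRegularity.NavierStokesRegularity.Theorems.PoloidalWindowDoorLrcModEntireTwistingTHFlatRidgeCubic

/-!
# Item `LrcModEntire` (stmt-NavierStokesRegularity-20428) — THE FLAT SUB-CELL: the WHOLE third derivative of `v₂(−1,·)` vanishes at a flat hot point, hence `∇Δv₂(−1,·)(y) = 0`

ns-k2-port-2 g7, helper of item 20428 under LEAD ns-poloidal-K2-p3 g15 (`--supports stmt-NavierStokesRegularity-20428 --as helper`).  Sequel of the LEAD's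
`…TwistingTHFlatRidgeJet` (Hessian of `σv₂(−1,·)` vanishes at a flat hot point) and `…TwistingTHFlatRidgeCubic` (the DIAGONAL cubic `D³(σv₂(−1,·))(y)[w,w,w]`
vanishes), memo `Cruxes/LrcModEntire/T2B-g15.md` §16b.  By polarisation of the symmetric trilinear form `D³f(y)` the diagonal statement is the full one:

* `thirdDeriv_eq_zero_of_diag` (class-free) — `f` of class `C³` at `y` and `D³f(y)[w,w,w] = 0` for all `w` ⇒ `D³f(y) = 0` (Schwarz symmetries in the slots
  `(1,2)` and `(2,3)` + the polarisation identities `D(w+e)+D(w−e) = 2D(w) + 6T(w,e,e)`, `2T(a,b,c) = S_a(b+c) − S_a(b) − S_a(c)`);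
* `fderiv_fderiv_fderiv_apply_eq` (class-free) — the currency bridge `D(D(x ↦ Df(x)c))(y)[a][b] = D³f(y)[a][b][c]` to `…FlatRidgeCubic`;
* `thirdDeriv_signed_eq_zero_of_flatHotPoint` — binder level (hypotheses of `…FlatRidgeCubic.cubic_eq_zero_of_flatHotPoint` VERBATIM): **`D³(σv₂(−1,·))(y) = 0`**;
* `hessian_two_eq_zero_of_flatHotPoint`, `thirdDeriv_two_eq_zero_of_flatHotPoint` — the same for the unsigned component `v₂(−1,·)` (`σ ≠ 0`);
* `laplacian_two_eq_zero_of_flatHotPoint`, ★ `fderiv_laplacian_two_eq_zero_of_flatHotPoint` — **`Δv₂(−1,·)(y) = 0` and `∇(Δv₂(−1,·))(y) = 0`** (trace of the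
  vanishing Hessian; `D(Δf) = Δ(Df)` at a `C³` point, `Literature…FirstIntegralTransportDefect.laplacian_fderiv_apply_of_contDiffAt`).
So `σv₂(−1,·) − |N|` vanishes to order four at every flat hot point in the honest tensor sense, and the viscous term of the vertical momentum equation is critical there
(consumed by `…TwistingTHFlatRidgePressurePins`: `∇(∂_z p)(−1,·)(y) = 0`).

WHAT THIS IS NOT: not a claim about Navier–Stokes regularity and not a proof of `stub_T2b` / `stub_T2bFlat`; point identities for the OPEN flat sub-cell
(bears_on LADDER-NS N0, item 20428 / crux 19708; OPEN).
-/

set_option linter.style.longLine false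
set_option linter.dupNamespace false

namespace Summit.NavierStokesRegularity.NavierStokesRegularity.Theorems.PoloidalWindowDoorLrcModEntireTwistingTHFlatRidgeThirdJet

open Set Function Filter Topology Metric
open scoped RealInnerProductSpace InnerProductSpace ContDiff Laplacian
open Literature.Analysis Literature.Analysis.FluidPDE Literature.Analysis.UnboundedOperators
open Summit.NavierStokesRegularity.NavierStokesRegularity.Theorems
open Summit.NavierStokesRegularity.NavierStokesRegularity.Theorems.LocalSineTubeDoorProfileAlignedWindowRigidityAncient
open Summit.NavierStokesRegularity.NavierStokesRegularity.Theorems.PoloidalWindowDoorLrcModEntireRidgeWiring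
open Summit.NavierStokesRegularity.NavierStokesRegularity.Theorems.PoloidalWindowDoorLrcModEntireThreadPins
open Summit.NavierStokesRegularity.NavierStokesRegularity.Theorems.PoloidalWindowDoorLrcModEntireTwistingTHHotPointPins
open Summit.NavierStokesRegularity.NavierStokesRegularity.Theorems.PoloidalWindowDoorLrcModEntireTwistingTHFlatRidgeJet
open Summit.NavierStokesRegularity.NavierStokesRegularity.Theorems.PoloidalWindowDoorLrcModEntireTwistingTHFlatRidgeCubic

/-! ### Class-free: symmetries of the third derivative and polarisation -/

section ClassFree

variable {E : Type*} [NormedAddCommGroup E] [NormedSpace ℝ E] {f : E → ℝ} {y : E}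

/-- Schwarz in the slots `(1,2)` of `D³f(y)`: `D³f(y)[a][b][c] = D³f(y)[b][a][c]` for `f` of class `C³` at `y`. [folklore] -/
theorem thirdDeriv_symm₁₂ (hf : ContDiffAt ℝ 3 f y) (a b c : E) :
    fderiv ℝ (fderiv ℝ (fderiv ℝ f)) y a b c = fderiv ℝ (fderiv ℝ (fderiv ℝ f)) y b a c := by
  have hDf : ContDiffAt ℝ 2 (fderiv ℝ f) y := hf.fderiv_right (m := 2) (by norm_num)
  have hsym3 : IsSymmSndFDerivAt ℝ (fderiv ℝ f) y := hDf.isSymmSndFDerivAt (by simp)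
  exact DFunLike.congr_fun (hsym3 a b) c

/-- Schwarz in the slots `(2,3)` of `D³f(y)`: `D³f(y)[a][b][c] = D³f(y)[a][c][b]` for `f` of class `C³` at `y` (differentiate the symmetry of `D²f` near `y`). [folklore] -/
theorem thirdDeriv_symm₂₃ (hf : ContDiffAt ℝ 3 f y) (a b c : E) :
    fderiv ℝ (fderiv ℝ (fderiv ℝ f)) y a b c = fderiv ℝ (fderiv ℝ (fderiv ℝ f)) y a c b := by
  have hDf : ContDiffAt ℝ 2 (fderiv ℝ f) y := hf.fderiv_right (m := 2) (by norm_num)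
  have hD2f : DifferentiableAt ℝ (fderiv ℝ (fderiv ℝ f)) y :=
    (hDf.fderiv_right (m := 1) (by norm_num)).differentiableAt one_ne_zero
  have hsym2 : ∀ᶠ x in 𝓝 y, IsSymmSndFDerivAt ℝ f x :=
    (hf.eventually (by simp)).mono fun x hx =>
      hx.isSymmSndFDerivAt (by simp only [minSmoothness_of_isRCLikeNormedField]; norm_num)
  have hev : (fun x => fderiv ℝ (fderiv ℝ f) x b c) =ᶠ[𝓝 y] fun x => fderiv ℝ (fderiv ℝ f) x c b :=
    hsym2.mono fun x hx => hx b c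
  have key : fderiv ℝ (fun x => fderiv ℝ (fderiv ℝ f) x b c) y a = fderiv ℝ (fun x => fderiv ℝ (fderiv ℝ f) x c b) y a :=
    DFunLike.congr_fun (hev.fderiv_eq (𝕜 := ℝ)) a
  have hd₂ : DifferentiableAt ℝ (fun x => fderiv ℝ (fderiv ℝ f) x b) y := hD2f.clm_apply (differentiableAt_const _)
  have hd₃ : DifferentiableAt ℝ (fun x => fderiv ℝ (fderiv ℝ f) x c) y := hD2f.clm_apply (differentiableAt_const _)
  rw [show (fun x => fderiv ℝ (fderiv ℝ f) x b c) = fun x => (fun x => fderiv ℝ (fderiv ℝ f) x b) x c from rfl,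
    fderiv_clm_apply hd₂ (differentiableAt_const _)] at key
  rw [show (fun x => fderiv ℝ (fderiv ℝ f) x c b) = fun x => (fun x => fderiv ℝ (fderiv ℝ f) x c) x b from rfl,
    fderiv_clm_apply hd₃ (differentiableAt_const _)] at key
  simpa [fderiv_apply_const_apply_eq_fderiv_fderiv hD2f] using key

/-- **Polarisation: a `C³` point with vanishing diagonal cubic has vanishing third derivative.**  If `D³f(y)[w][w][w] = 0` for every `w` then
`D³f(y)[a][b][c] = 0` for all `a b c`. -/
theorem thirdDeriv_eq_zero_of_diag (hf : ContDiffAt ℝ 3 f y) (hdiag : ∀ w, fderiv ℝ (fderiv ℝ (fderiv ℝ f)) y w w w = 0) (a b c : E) :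
    fderiv ℝ (fderiv ℝ (fderiv ℝ f)) y a b c = 0 := by
  set T := fderiv ℝ (fderiv ℝ (fderiv ℝ f)) y with hT
  have h12 : ∀ a b c, T a b c = T b a c := fun a b c => thirdDeriv_symm₁₂ hf a b c
  have h23 : ∀ a b c, T a b c = T a c b := fun a b c => thirdDeriv_symm₂₃ hf a b c
  -- step 1: `T w e e = 0`
  have hwee : ∀ w e, T w e e = 0 := by
    intro w e
    have h1 := hdiag (w + e)
    have h2 := hdiag (w - e)
    simp only [map_add, map_sub, add_apply, sub_apply] at h1 h2
    linarith [hdiag w, hdiag e, h12 e w e, h23 e e w, h12 e w w, h23 w e w, h23 w w e]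
  -- step 2: polarise the symmetric bilinear form `(b, c) ↦ T a b c`
  have h3 := hwee a (b + c)
  simp only [map_add, add_apply] at h3
  linarith [hwee a b, hwee a c, h23 a b c]

/-- Currency bridge to `…FlatRidgeCubic`: `D(D(x ↦ Df(x) c))(y)[a][b] = D³f(y)[a][b][c]` for `f ∈ C³`. [folklore] -/
theorem fderiv_fderiv_fderiv_apply_eq (hf : ContDiff ℝ 3 f) (y a b c : E) :
    fderiv ℝ (fderiv ℝ (fun x => fderiv ℝ f x c)) y a b = fderiv ℝ (fderiv ℝ (fderiv ℝ f)) y a b c := by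
  have hf2 : ContDiff ℝ 2 f := hf.of_le (by norm_num)
  have hDf : ContDiff ℝ 2 (fderiv ℝ f) := hf.fderiv_right (m := 2) (by norm_num)
  have hD2d : ∀ x, DifferentiableAt ℝ (fderiv ℝ (fderiv ℝ f)) x := fun x =>
    ((hDf.fderiv_right (m := 1) (by norm_num)).differentiable one_ne_zero) x
  have hDd : ∀ x, DifferentiableAt ℝ (fderiv ℝ f) x := fun x => ((hf2.fderiv_right (m := 1) (by norm_num)).differentiable one_ne_zero) x
  have hkc : ContDiff ℝ 2 (fun x => fderiv ℝ f x c) := hDf.clm_apply contDiff_const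
  rw [fderiv_fderiv_eq_coord hkc y a b]
  have e1 : (fun x => fderiv ℝ (fun x' => fderiv ℝ f x' c) x b) = fun x => fderiv ℝ (fderiv ℝ f) x b c :=
    funext fun x => fderiv_apply_const_apply_eq_fderiv_fderiv (hDd x) b c
  rw [e1, show (fun x => fderiv ℝ (fderiv ℝ f) x b c) = fun x => (fun x => fderiv ℝ (fderiv ℝ f) x b) x c from rfl,
    fderiv_clm_apply ((hD2d y).clm_apply (differentiableAt_const _)) (differentiableAt_const _)]
  simp [fderiv_apply_const_apply_eq_fderiv_fderiv (hD2d y)]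

/-- **Polarisation in the currency of `…FlatRidgeCubic`**: `f ∈ C³`, `D(D(x ↦ Df(x) w))(y)[w][w] = 0` for all `w` ⇒ the whole third derivative `D³f(y)` vanishes. -/
theorem fderiv_fderiv_fderiv_eq_zero_of_diag (hf : ContDiff ℝ 3 f) (y : E)
    (hdiag : ∀ w, fderiv ℝ (fderiv ℝ (fun x => fderiv ℝ f x w)) y w w = 0) :
    fderiv ℝ (fderiv ℝ (fderiv ℝ f)) y = 0 := by
  ext a b c
  have hdiag' : ∀ w, fderiv ℝ (fderiv ℝ (fderiv ℝ f)) y w w w = 0 := fun w => by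
    rw [← fderiv_fderiv_fderiv_apply_eq hf y w w w]; exact hdiag w
  simpa using thirdDeriv_eq_zero_of_diag hf.contDiffAt hdiag' a b c

end ClassFree

/-- **`∇(Δf)(y) = 0` when `D³f(y) = 0`** (`f` of class `C³` at `y`, on a finite-dimensional inner product space): `D(Δf)(y) w = (Δ(Df))(y) w = ∑ᵢ D³f(y)[eᵢ][eᵢ] w`. -/
theorem fderiv_laplacian_eq_zero_of_thirdDeriv_eq_zero {E : Type*} [NormedAddCommGroup E] [InnerProductSpace ℝ E] [FiniteDimensional ℝ E]
    {f : E → ℝ} {y : E} (hf : ContDiffAt ℝ 3 f y) (h3 : fderiv ℝ (fderiv ℝ (fderiv ℝ f)) y = 0) :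
    fderiv ℝ (Δ f) y = 0 := by
  ext w
  rw [← laplacian_fderiv_apply_of_contDiffAt (stdOrthonormalBasis ℝ E) hf w,
    laplacian_eq_sum_fderiv_fderiv_curried (stdOrthonormalBasis ℝ E) (fderiv ℝ f) y, h3]
  simp

/-! ### Binder level: the flat hot point of a (TH)-column profile -/

variable {C : ℝ} {v : ℝ → EuclideanSpace ℝ (Fin 3) → EuclideanSpace ℝ (Fin 3)}

/-- **At a flat hot point the WHOLE third derivative of `σv₂(−1,·)` vanishes.**  Hypotheses = those of `…FlatRidgeCubic.cubic_eq_zero_of_flatHotPoint` VERBATIM. -/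
theorem thirdDeriv_signed_eq_zero_of_flatHotPoint (hdec : HasTypeITimeDecay C v) (hcont : ContinuousOn (uncurry v) (Iio (0 : ℝ) ×ˢ univ))
    (hmild : ∀ s t : ℝ, s < t → t < 0 → ∀ x, v t x = heatExtension (v s) (t - s) x - oseenDuhamel 1 s v v t x)
    (hdiv : ∀ t < 0, VectorCalculus.IsDivFree (v t))
    (hTH : ∀ t < 0, ∀ x x' : EuclideanSpace ℝ (Fin 3), x 2 = x' 2 → ∀ b c : Fin 3, b ≠ 2 → c ≠ 2 →
      fderiv ℝ (v t) x (EuclideanSpace.single 2 1) b * fderiv ℝ (v t) x' (EuclideanSpace.single c 1) 2 =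
        fderiv ℝ (v t) x' (EuclideanSpace.single 2 1) c * fderiv ℝ (v t) x (EuclideanSpace.single b 1) 2)
    (hne : v (-1) 0 2 ≠ 0) (hhot : ∀ t < 0, ∀ x, Real.sqrt (-t) * |v t x 2| ≤ |v (-1) 0 2|)
    (hproper : ∀ y ∈ {y : EuclideanSpace ℝ (Fin 3) | y 2 = 0 ∧ v (-1) y 2 = v (-1) 0 2}, ∀ r : ℝ, 0 < r →
      ∃ y' : EuclideanSpace ℝ (Fin 3), y' 2 = 0 ∧ dist y' y < r ∧ v (-1) y' 2 ≠ v (-1) 0 2)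
    {σ : ℝ} (hσN : σ * v (-1) 0 2 = |v (-1) 0 2|)
    {y : EuclideanSpace ℝ (Fin 3)} (hy0 : y 2 = 0) (hy : v (-1) y 2 = v (-1) 0 2)
    (hflat : fderiv ℝ (fderiv ℝ (fun x => σ * v (-1) x 2)) y (EuclideanSpace.single 0 1) (EuclideanSpace.single 0 1) +
      fderiv ℝ (fderiv ℝ (fun x => σ * v (-1) x 2)) y (EuclideanSpace.single 1 1) (EuclideanSpace.single 1 1) = 0) :
    fderiv ℝ (fderiv ℝ (fderiv ℝ (fun x => σ * v (-1) x 2))) y = 0 := by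
  have h1 : (-1 : ℝ) < 0 := by norm_num
  have hslice_an : AnalyticOnNhd ℝ (v (-1)) univ := analyticOnNhd_slice hcont (bdd_of_hasTypeITimeDecay hdec) hmild h1
  have hfa : AnalyticOnNhd ℝ (fun x => σ * v (-1) x 2) univ := fun x hx =>
    analyticAt_const.mul (((EuclideanSpace.proj (𝕜 := ℝ) (2 : Fin 3)).analyticAt _).comp (hslice_an x hx))
  have hf3 : ContDiff ℝ 3 (fun x => σ * v (-1) x 2) := hfa.contDiff.of_le le_top
  exact fderiv_fderiv_fderiv_eq_zero_of_diag hf3 y fun w =>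
    cubic_eq_zero_of_flatHotPoint hdec hcont hmild hdiv hTH hne hhot hproper hσN hy0 hy hflat w

/-- The signed component is `σ •` the component: `(x ↦ σ·v₂(−1,x)) = σ • (x ↦ v₂(−1,x))`. -/
theorem signed_eq_smul (σ : ℝ) : (fun x : EuclideanSpace ℝ (Fin 3) => σ * v (-1) x 2) = σ • (fun x => (v (-1) x 2 : ℝ)) := by
  funext x; simp [smul_eq_mul]

/-- The component `x ↦ v₂(−1,x)` of a class profile is smooth. -/
theorem contDiff_two_component (hdec : HasTypeITimeDecay C v) (hcont : ContinuousOn (uncurry v) (Iio (0 : ℝ) ×ˢ univ))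
    (hmild : ∀ s t : ℝ, s < t → t < 0 → ∀ x, v t x = heatExtension (v s) (t - s) x - oseenDuhamel 1 s v v t x) {n : WithTop ℕ∞} :
    ContDiff ℝ n (fun x => (v (-1) x 2 : ℝ)) := by
  have hslice_an : AnalyticOnNhd ℝ (v (-1)) univ :=
    analyticOnNhd_slice hcont (bdd_of_hasTypeITimeDecay hdec) hmild (by norm_num : (-1 : ℝ) < 0)
  have hθan : AnalyticOnNhd ℝ (fun x => (v (-1) x 2 : ℝ)) univ := fun x hx =>
    ((EuclideanSpace.proj (𝕜 := ℝ) (2 : Fin 3)).analyticAt _).comp (hslice_an x hx)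
  exact hθan.contDiff

/-- **Hessian of the unsigned component at a flat hot point: `D²(v₂(−1,·))(y) = 0`** (`…FlatRidgeJet.hessian_eq_zero_of_flatHotPoint` divided by `σ ≠ 0`). -/
theorem hessian_two_eq_zero_of_flatHotPoint (hdec : HasTypeITimeDecay C v) (hcont : ContinuousOn (uncurry v) (Iio (0 : ℝ) ×ˢ univ))
    (hmild : ∀ s t : ℝ, s < t → t < 0 → ∀ x, v t x = heatExtension (v s) (t - s) x - oseenDuhamel 1 s v v t x)
    (hdiv : ∀ t < 0, VectorCalculus.IsDivFree (v t))
    (hTH : ∀ t < 0, ∀ x x' : EuclideanSpace ℝ (Fin 3), x 2 = x' 2 → ∀ b c : Fin 3, b ≠ 2 → c ≠ 2 →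
      fderiv ℝ (v t) x (EuclideanSpace.single 2 1) b * fderiv ℝ (v t) x' (EuclideanSpace.single c 1) 2 =
        fderiv ℝ (v t) x' (EuclideanSpace.single 2 1) c * fderiv ℝ (v t) x (EuclideanSpace.single b 1) 2)
    (hne : v (-1) 0 2 ≠ 0) (hhot : ∀ t < 0, ∀ x, Real.sqrt (-t) * |v t x 2| ≤ |v (-1) 0 2|)
    (hproper : ∀ y ∈ {y : EuclideanSpace ℝ (Fin 3) | y 2 = 0 ∧ v (-1) y 2 = v (-1) 0 2}, ∀ r : ℝ, 0 < r →
      ∃ y' : EuclideanSpace ℝ (Fin 3), y' 2 = 0 ∧ dist y' y < r ∧ v (-1) y' 2 ≠ v (-1) 0 2)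
    {σ : ℝ} (hσN : σ * v (-1) 0 2 = |v (-1) 0 2|)
    {y : EuclideanSpace ℝ (Fin 3)} (hy0 : y 2 = 0) (hy : v (-1) y 2 = v (-1) 0 2)
    (hflat : fderiv ℝ (fderiv ℝ (fun x => σ * v (-1) x 2)) y (EuclideanSpace.single 0 1) (EuclideanSpace.single 0 1) +
      fderiv ℝ (fderiv ℝ (fun x => σ * v (-1) x 2)) y (EuclideanSpace.single 1 1) (EuclideanSpace.single 1 1) = 0) :
    fderiv ℝ (fderiv ℝ (fun x => (v (-1) x 2 : ℝ))) y = 0 := by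
  have hσ0 : σ ≠ 0 := by
    intro h; rw [h, zero_mul] at hσN; exact (abs_pos.2 hne).ne' hσN.symm |>.elim
  set θ : EuclideanSpace ℝ (Fin 3) → ℝ := fun x => v (-1) x 2 with hθdef
  have hθ : ContDiff ℝ 2 θ := contDiff_two_component hdec hcont hmild
  have hθd : Differentiable ℝ θ := hθ.differentiable (by norm_num)
  have hDθd : Differentiable ℝ (fderiv ℝ θ) := (hθ.fderiv_right (m := 1) (by norm_num)).differentiable one_ne_zero
  have hD1 : fderiv ℝ (fun x => σ * v (-1) x 2) = σ • fderiv ℝ θ := by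
    rw [signed_eq_smul σ]; funext x; exact fderiv_const_smul (hθd x) σ
  have hD2 : fderiv ℝ (fderiv ℝ (fun x => σ * v (-1) x 2)) y = σ • fderiv ℝ (fderiv ℝ θ) y := by
    rw [hD1]; exact fderiv_const_smul (hDθd y) σ
  have hH := hessian_eq_zero_of_flatHotPoint hdec hcont hmild hdiv hTH hne hhot hproper hσN hy0 hy hflat
  ext u w
  have h := hH u w
  rw [hD2] at h
  simp only [smul_apply, smul_eq_mul, mul_eq_zero] at h
  simpa using h.resolve_left hσ0

/-- **Third derivative of the unsigned component at a flat hot point: `D³(v₂(−1,·))(y) = 0`.** -/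
theorem thirdDeriv_two_eq_zero_of_flatHotPoint (hdec : HasTypeITimeDecay C v) (hcont : ContinuousOn (uncurry v) (Iio (0 : ℝ) ×ˢ univ))
    (hmild : ∀ s t : ℝ, s < t → t < 0 → ∀ x, v t x = heatExtension (v s) (t - s) x - oseenDuhamel 1 s v v t x)
    (hdiv : ∀ t < 0, VectorCalculus.IsDivFree (v t))
    (hTH : ∀ t < 0, ∀ x x' : EuclideanSpace ℝ (Fin 3), x 2 = x' 2 → ∀ b c : Fin 3, b ≠ 2 → c ≠ 2 →
      fderiv ℝ (v t) x (EuclideanSpace.single 2 1) b * fderiv ℝ (v t) x' (EuclideanSpace.single c 1) 2 =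
        fderiv ℝ (v t) x' (EuclideanSpace.single 2 1) c * fderiv ℝ (v t) x (EuclideanSpace.single b 1) 2)
    (hne : v (-1) 0 2 ≠ 0) (hhot : ∀ t < 0, ∀ x, Real.sqrt (-t) * |v t x 2| ≤ |v (-1) 0 2|)
    (hproper : ∀ y ∈ {y : EuclideanSpace ℝ (Fin 3) | y 2 = 0 ∧ v (-1) y 2 = v (-1) 0 2}, ∀ r : ℝ, 0 < r →
      ∃ y' : EuclideanSpace ℝ (Fin 3), y' 2 = 0 ∧ dist y' y < r ∧ v (-1) y' 2 ≠ v (-1) 0 2)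
    {σ : ℝ} (hσN : σ * v (-1) 0 2 = |v (-1) 0 2|)
    {y : EuclideanSpace ℝ (Fin 3)} (hy0 : y 2 = 0) (hy : v (-1) y 2 = v (-1) 0 2)
    (hflat : fderiv ℝ (fderiv ℝ (fun x => σ * v (-1) x 2)) y (EuclideanSpace.single 0 1) (EuclideanSpace.single 0 1) +
      fderiv ℝ (fderiv ℝ (fun x => σ * v (-1) x 2)) y (EuclideanSpace.single 1 1) (EuclideanSpace.single 1 1) = 0) :
    fderiv ℝ (fderiv ℝ (fderiv ℝ (fun x => (v (-1) x 2 : ℝ)))) y = 0 := by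
  have hσ0 : σ ≠ 0 := by
    intro h; rw [h, zero_mul] at hσN; exact (abs_pos.2 hne).ne' hσN.symm |>.elim
  set θ : EuclideanSpace ℝ (Fin 3) → ℝ := fun x => v (-1) x 2 with hθdef
  have hθ : ContDiff ℝ 3 θ := contDiff_two_component hdec hcont hmild
  have hθd : Differentiable ℝ θ := hθ.differentiable (by norm_num)
  have hg : ∀ w, ContDiff ℝ 2 (fun x => fderiv ℝ θ x w) := fun w => (hθ.fderiv_right (m := 2) (by norm_num)).clm_apply contDiff_const
  -- transfer the diagonal cubic from `σθ` to `θ` (curried currency, scalar-valued functions)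
  have hdiagθ : ∀ w, fderiv ℝ (fderiv ℝ (fun x => fderiv ℝ θ x w)) y w w = 0 := by
    intro w
    have hc := cubic_eq_zero_of_flatHotPoint hdec hcont hmild hdiv hTH hne hhot hproper hσN hy0 hy hflat w
    have hgd : Differentiable ℝ (fun x => fderiv ℝ θ x w) := (hg w).differentiable (by norm_num)
    have hDgd : Differentiable ℝ (fderiv ℝ (fun x => fderiv ℝ θ x w)) :=
      ((hg w).fderiv_right (m := 1) (by norm_num)).differentiable one_ne_zero
    have e1 : (fun x => fderiv ℝ (fun x => σ * v (-1) x 2) x w) = σ • (fun x => fderiv ℝ θ x w) := by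
      funext x
      rw [signed_eq_smul σ, fderiv_const_smul (hθd x) σ]
      simp [smul_eq_mul, hθdef]
    have e2 : fderiv ℝ (fun x => fderiv ℝ (fun x => σ * v (-1) x 2) x w) = σ • fderiv ℝ (fun x => fderiv ℝ θ x w) := by
      rw [e1]; funext x; exact fderiv_const_smul (hgd x) σ
    have e3 : fderiv ℝ (fderiv ℝ (fun x => fderiv ℝ (fun x => σ * v (-1) x 2) x w)) y = σ • fderiv ℝ (fderiv ℝ (fun x => fderiv ℝ θ x w)) y := by
      rw [e2]; exact fderiv_const_smul (hDgd y) σ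
    rw [e3] at hc
    simp only [smul_apply, smul_eq_mul, mul_eq_zero] at hc
    exact hc.resolve_left hσ0
  exact fderiv_fderiv_fderiv_eq_zero_of_diag hθ y hdiagθ

/-- **`Δv₂(−1,·)(y) = 0` at a flat hot point** (trace of the vanishing Hessian). -/
theorem laplacian_two_eq_zero_of_flatHotPoint (hdec : HasTypeITimeDecay C v) (hcont : ContinuousOn (uncurry v) (Iio (0 : ℝ) ×ˢ univ))
    (hmild : ∀ s t : ℝ, s < t → t < 0 → ∀ x, v t x = heatExtension (v s) (t - s) x - oseenDuhamel 1 s v v t x)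
    (hdiv : ∀ t < 0, VectorCalculus.IsDivFree (v t))
    (hTH : ∀ t < 0, ∀ x x' : EuclideanSpace ℝ (Fin 3), x 2 = x' 2 → ∀ b c : Fin 3, b ≠ 2 → c ≠ 2 →
      fderiv ℝ (v t) x (EuclideanSpace.single 2 1) b * fderiv ℝ (v t) x' (EuclideanSpace.single c 1) 2 =
        fderiv ℝ (v t) x' (EuclideanSpace.single 2 1) c * fderiv ℝ (v t) x (EuclideanSpace.single b 1) 2)
    (hne : v (-1) 0 2 ≠ 0) (hhot : ∀ t < 0, ∀ x, Real.sqrt (-t) * |v t x 2| ≤ |v (-1) 0 2|)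
    (hproper : ∀ y ∈ {y : EuclideanSpace ℝ (Fin 3) | y 2 = 0 ∧ v (-1) y 2 = v (-1) 0 2}, ∀ r : ℝ, 0 < r →
      ∃ y' : EuclideanSpace ℝ (Fin 3), y' 2 = 0 ∧ dist y' y < r ∧ v (-1) y' 2 ≠ v (-1) 0 2)
    {σ : ℝ} (hσN : σ * v (-1) 0 2 = |v (-1) 0 2|)
    {y : EuclideanSpace ℝ (Fin 3)} (hy0 : y 2 = 0) (hy : v (-1) y 2 = v (-1) 0 2)
    (hflat : fderiv ℝ (fderiv ℝ (fun x => σ * v (-1) x 2)) y (EuclideanSpace.single 0 1) (EuclideanSpace.single 0 1) +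
      fderiv ℝ (fderiv ℝ (fun x => σ * v (-1) x 2)) y (EuclideanSpace.single 1 1) (EuclideanSpace.single 1 1) = 0) :
    (Δ (fun x => (v (-1) x 2 : ℝ))) y = 0 := by
  rw [laplacian_eq_sum_fderiv_fderiv_curried (stdOrthonormalBasis ℝ (EuclideanSpace ℝ (Fin 3))) (fun x => (v (-1) x 2 : ℝ)) y,
    hessian_two_eq_zero_of_flatHotPoint hdec hcont hmild hdiv hTH hne hhot hproper hσN hy0 hy hflat]
  simp

/-- ★ **`∇(Δv₂(−1,·))(y) = 0` at a flat hot point**: the viscous term of the vertical momentum equation is critical on the flat hot web. -/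
theorem fderiv_laplacian_two_eq_zero_of_flatHotPoint (hdec : HasTypeITimeDecay C v) (hcont : ContinuousOn (uncurry v) (Iio (0 : ℝ) ×ˢ univ))
    (hmild : ∀ s t : ℝ, s < t → t < 0 → ∀ x, v t x = heatExtension (v s) (t - s) x - oseenDuhamel 1 s v v t x)
    (hdiv : ∀ t < 0, VectorCalculus.IsDivFree (v t))
    (hTH : ∀ t < 0, ∀ x x' : EuclideanSpace ℝ (Fin 3), x 2 = x' 2 → ∀ b c : Fin 3, b ≠ 2 → c ≠ 2 →
      fderiv ℝ (v t) x (EuclideanSpace.single 2 1) b * fderiv ℝ (v t) x' (EuclideanSpace.single c 1) 2 =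
        fderiv ℝ (v t) x' (EuclideanSpace.single 2 1) c * fderiv ℝ (v t) x (EuclideanSpace.single b 1) 2)
    (hne : v (-1) 0 2 ≠ 0) (hhot : ∀ t < 0, ∀ x, Real.sqrt (-t) * |v t x 2| ≤ |v (-1) 0 2|)
    (hproper : ∀ y ∈ {y : EuclideanSpace ℝ (Fin 3) | y 2 = 0 ∧ v (-1) y 2 = v (-1) 0 2}, ∀ r : ℝ, 0 < r →
      ∃ y' : EuclideanSpace ℝ (Fin 3), y' 2 = 0 ∧ dist y' y < r ∧ v (-1) y' 2 ≠ v (-1) 0 2)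
    {σ : ℝ} (hσN : σ * v (-1) 0 2 = |v (-1) 0 2|)
    {y : EuclideanSpace ℝ (Fin 3)} (hy0 : y 2 = 0) (hy : v (-1) y 2 = v (-1) 0 2)
    (hflat : fderiv ℝ (fderiv ℝ (fun x => σ * v (-1) x 2)) y (EuclideanSpace.single 0 1) (EuclideanSpace.single 0 1) +
      fderiv ℝ (fderiv ℝ (fun x => σ * v (-1) x 2)) y (EuclideanSpace.single 1 1) (EuclideanSpace.single 1 1) = 0) :
    fderiv ℝ (Δ (fun x => (v (-1) x 2 : ℝ))) y = 0 := by
  have hθ : ContDiff ℝ 3 (fun x => (v (-1) x 2 : ℝ)) := contDiff_two_component hdec hcont hmild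
  exact fderiv_laplacian_eq_zero_of_thirdDeriv_eq_zero hθ.contDiffAt
    (thirdDeriv_two_eq_zero_of_flatHotPoint hdec hcont hmild hdiv hTH hne hhot hproper hσN hy0 hy hflat)

end Summit.NavierStokesRegularity.NavierStokesRegularity.Theorems.PoloidalWindowDoorLrcModEntireTwistingTHFlatRidgeThirdJet
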